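import Mathlib
import HarnessLib
import Summits.NavierStokesRegularity.NavierStokesRegularity.Theorems.LoopPeriodRatchetNoPlanarExtremumSard
import Summits.NavierStokesRegularity.NavierStokesRegularity.Theorems.PoloidalWindowDoorPoloidalWindowRigidityLevelDependence

/-!
# Route `PoloidalWindowDoor`, crux `PoloidalWindowRigidity` (K2, stmt-NavierStokesRegularity-19708) — NULL CHARTS: near a
# regular point of a first integral `f` of a planar Hamiltonian field `X = J∇G`, the planar zeros of `X` are read off
# the LEVEL of `f` (towards the null-present half of stub HP1 `stub_islandOrNull`, line `hot_loops` v2, ns-idea-8 g6)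

Cell ns-regularity-ideate, seat ns-poloidal-K2-p2 g11 (stub-worker on K2; `--supports` the crux item).

* `exists_Ioo_subset_of_closed_cover` — Baire on `ℝ`: if countably many closed sets cover an open interval, one of
  them contains an open sub-interval;
* `exists_nullChart` — `X : ℝ³ → ℝ³` horizontal with planar stream function `G` (`∂₀G = −X₁`, `∂₁G = X₀`), `f ∈ C¹` with
  `Df(X) ≡ 0`, `z` a point with `∇_h f(z) ≠ 0`: there are `κ : ℝ → ℝ` and a neighbourhood `U` of `z` such that for
  `y ∈ U` in the horizontal plane of `z`: `X y = 0 ↔ κ (f y) = 0`, and `∇_h f(y) ≠ 0` (transfer of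
  `…LevelDependence.exists_levelFactor` through the affine chart `q ↦ z + q₁ e_A + q₂ e_B`).

WHAT THIS IS NOT: not a claim about Navier–Stokes — calculus/topology helpers for one stub of an ideator line of a
door route (bears_on LADDER-NS N0, rung N0-LocalTubeDoorPoloidal).
-/

noncomputable section

-- the summit and its single sub-problem share the name (CONVENTIONS §1), as in every Theorems file
set_option linter.dupNamespace false

namespace Summit.NavierStokesRegularity.NavierStokesRegularity.Theorems.PoloidalWindowDoorPoloidalWindowRigidityNullCharts

open Set Function Filter Topology Metric
open Summit.NavierStokesRegularity.NavierStokesRegularity.Theorems.LoopPeriodRatchetNoPlanarExtremumSard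
open Summit.NavierStokesRegularity.NavierStokesRegularity.Theorems.PoloidalWindowDoorPoloidalWindowRigidityLevelDependence

/-! ### Baire on the line -/

/-- **Baire on `ℝ`.**  If closed sets `S i`, `i` in a countable type, cover the open interval `(a, b)` (`a < b`), then
some `S i` contains an open interval `(a', b') ⊆ (a, b)`. -/
theorem exists_Ioo_subset_of_closed_cover {ι : Type*} [Countable ι] (S : ι → Set ℝ) (hS : ∀ i, IsClosed (S i))
    {a b : ℝ} (hab : a < b) (hcov : Ioo a b ⊆ ⋃ i, S i) :
    ∃ i, ∃ a' b' : ℝ, a' < b' ∧ Ioo a' b' ⊆ S i ∩ Ioo a b := by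
  classical
  set T : Option ι → Set ℝ := fun j => j.elim (Iic a ∪ Ici b) S with hT
  have hTc : ∀ j, IsClosed (T j) := by
    rintro (_ | i)
    · exact isClosed_Iic.union isClosed_Ici
    · exact hS i
  have hTU : (⋃ j, T j) = univ := by
    refine eq_univ_of_forall fun x => ?_
    by_cases hx : x ∈ Ioo a b
    · obtain ⟨i, hi⟩ := mem_iUnion.1 (hcov hx)
      exact mem_iUnion.2 ⟨some i, hi⟩
    · refine mem_iUnion.2 ⟨none, ?_⟩
      simp only [mem_Ioo, not_and_or, not_lt] at hx
      rcases hx with h | h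
      · exact Or.inl h
      · exact Or.inr h
  have hdense := dense_iUnion_interior_of_closed hTc hTU
  obtain ⟨x, hxab, hx⟩ := hdense.inter_open_nonempty (Ioo a b) isOpen_Ioo ⟨(a + b) / 2, by constructor <;> linarith⟩
  obtain ⟨j, hj⟩ := mem_iUnion.1 hx
  obtain ⟨ε, hε, hball⟩ := Metric.isOpen_iff.1 isOpen_interior x hj
  have hsub : Ioo (x - ε) (x + ε) ⊆ T j := fun y hy =>
    interior_subset (hball (by rw [mem_ball, Real.dist_eq, abs_lt]; constructor <;> linarith [hy.1, hy.2]))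
  rcases j with _ | i
  · exfalso
    have hx' : x ∈ Iic a ∪ Ici b := hsub ⟨by linarith, by linarith⟩
    rcases hx' with h | h
    · exact absurd hxab.1 (not_lt.2 h)
    · exact absurd hxab.2 (not_lt.2 h)
  · refine ⟨i, max (x - ε) a, min (x + ε) b, ?_, fun y hy => ⟨hsub ⟨?_, ?_⟩, ?_, ?_⟩⟩
    · exact (max_lt (by linarith) hxab.1).trans (lt_min (by linarith) hxab.2)
    · exact lt_of_le_of_lt (le_max_left _ _) hy.1
    · exact lt_of_lt_of_le hy.2 (min_le_left _ _)
    · exact lt_of_le_of_lt (le_max_right _ _) hy.1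
    · exact lt_of_lt_of_le hy.2 (min_le_right _ _)

/-! ### Null charts -/

/-- A horizontal vector in the frame `(e_A, e_B)`, `{A, B} = {0, 1}`. -/
theorem eq_smul_add_smul_of_horizontal {iA iB : Fin 3} (hA : iA ≠ 2) (hB : iB ≠ 2) (hAB : iA ≠ iB)
    {w : EuclideanSpace ℝ (Fin 3)} (hw : w 2 = 0) :
    w = w iA • EuclideanSpace.single iA 1 + w iB • EuclideanSpace.single iB 1 := by
  ext i
  fin_cases iA <;> fin_cases iB <;> fin_cases i <;> simp_all

/-- **Null chart in a frame.**  `X` horizontal, `f, G ∈ C¹(ℝ³)` with the bracket `∂_Af·∂_BG − ∂_Bf·∂_AG ≡ 0` in a horizontal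
frame `(e_A, e_B)` (`{A,B} = {0,1}`), the planar zeros of `X` being the common zeros of `∂_AG, ∂_BG`, and `∂_Bf(z) ≠ 0`:
near `z`, in the plane of `z`, `X y = 0 ↔ κ (f y) = 0` for some `κ`, and `∂_Bf ≠ 0`. -/
theorem exists_nullChart_frame {X : EuclideanSpace ℝ (Fin 3) → EuclideanSpace ℝ (Fin 3)}
    {f G : EuclideanSpace ℝ (Fin 3) → ℝ} (hf : ContDiff ℝ 1 f) (hG : ContDiff ℝ 1 G)
    {iA iB : Fin 3} (hA : iA ≠ 2) (hB : iB ≠ 2) (hAB : iA ≠ iB)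
    (hbr : ∀ y, fderiv ℝ f y (EuclideanSpace.single iA 1) * fderiv ℝ G y (EuclideanSpace.single iB 1) -
      fderiv ℝ f y (EuclideanSpace.single iB 1) * fderiv ℝ G y (EuclideanSpace.single iA 1) = 0)
    (hXiff : ∀ y, X y = 0 ↔ fderiv ℝ G y (EuclideanSpace.single iA 1) = 0 ∧
      fderiv ℝ G y (EuclideanSpace.single iB 1) = 0)
    {z : EuclideanSpace ℝ (Fin 3)} (hzB : fderiv ℝ f z (EuclideanSpace.single iB 1) ≠ 0) :
    ∃ κ : ℝ → ℝ, ∃ U ∈ 𝓝 z, ∀ y ∈ U, y 2 = z 2 →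
      (X y = 0 ↔ κ (f y) = 0) ∧ fderiv ℝ f y (EuclideanSpace.single iB 1) ≠ 0 := by
  have hfd : Differentiable ℝ f := hf.differentiable one_ne_zero
  have hGd : Differentiable ℝ G := hG.differentiable one_ne_zero
  set eA : EuclideanSpace ℝ (Fin 3) := EuclideanSpace.single iA 1 with heA
  set eB : EuclideanSpace ℝ (Fin 3) := EuclideanSpace.single iB 1 with heB
  -- the affine chart and its derivative
  set L : ℝ × ℝ →L[ℝ] EuclideanSpace ℝ (Fin 3) :=
    (ContinuousLinearMap.fst ℝ ℝ ℝ).smulRight eA + (ContinuousLinearMap.snd ℝ ℝ ℝ).smulRight eB with hL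
  have hLk : ∀ k : ℝ × ℝ, L k = k.1 • eA + k.2 • eB := fun k => by simp [hL]
  set ι : ℝ × ℝ → EuclideanSpace ℝ (Fin 3) := fun q => z + L q with hι
  have hιd : ∀ q, HasFDerivAt ι L q := fun q => (L.hasFDerivAt).const_add z
  have hιc1 : ContDiff ℝ 1 ι := contDiff_const.add L.contDiff
  have hιq : ∀ q, ι q = z + q.1 • eA + q.2 • eB := fun q => by rw [hι]; dsimp only; rw [hLk, add_assoc]
  -- the planar functions and their partials
  set ft : ℝ × ℝ → ℝ := f ∘ ι with hft
  set Gt : ℝ × ℝ → ℝ := G ∘ ι with hGt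
  have hftc : ContDiff ℝ 1 ft := hf.comp hιc1
  have hGtc : ContDiff ℝ 1 Gt := hG.comp hιc1
  have hftD : ∀ q k, fderiv ℝ ft q k = fderiv ℝ f (ι q) (k.1 • eA + k.2 • eB) := by
    intro q k
    rw [hft, ((hfd (ι q)).hasFDerivAt.comp q (hιd q)).fderiv, ContinuousLinearMap.comp_apply, hLk]
  have hGtD : ∀ q k, fderiv ℝ Gt q k = fderiv ℝ G (ι q) (k.1 • eA + k.2 • eB) := by
    intro q k
    rw [hGt, ((hGd (ι q)).hasFDerivAt.comp q (hιd q)).fderiv, ContinuousLinearMap.comp_apply, hLk]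
  have h10 : ∀ q, fderiv ℝ ft q (1, 0) = fderiv ℝ f (ι q) eA ∧ fderiv ℝ Gt q (1, 0) = fderiv ℝ G (ι q) eA :=
    fun q => ⟨by rw [hftD]; simp, by rw [hGtD]; simp⟩
  have h01 : ∀ q, fderiv ℝ ft q (0, 1) = fderiv ℝ f (ι q) eB ∧ fderiv ℝ Gt q (0, 1) = fderiv ℝ G (ι q) eB :=
    fun q => ⟨by rw [hftD]; simp, by rw [hGtD]; simp⟩
  have hbrt : ∀ q : ℝ × ℝ, fderiv ℝ ft q (1, 0) * fderiv ℝ Gt q (0, 1) - fderiv ℝ ft q (0, 1) * fderiv ℝ Gt q (1, 0) = 0 :=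
    fun q => by rw [(h10 q).1, (h10 q).2, (h01 q).1, (h01 q).2]; exact hbr (ι q)
  have hreg0 : fderiv ℝ ft 0 (0, 1) ≠ 0 := by
    rw [(h01 0).1]
    have : ι 0 = z := by rw [hιq]; simp
    rwa [this]
  -- the planar level factor
  obtain ⟨κ, V, hV, hVprop⟩ := exists_levelFactor hftc hGtc hbrt hreg0
  -- pull back to `ℝ³`: coordinates of a planar point relative to `z`
  set crd : EuclideanSpace ℝ (Fin 3) → ℝ × ℝ := fun y => ((y - z) iA, (y - z) iB) with hcrd
  have hcrdc : Continuous crd := by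
    have h1 : Continuous fun y : EuclideanSpace ℝ (Fin 3) => (y - z) iA :=
      (EuclideanSpace.proj iA).continuous.comp (continuous_id.sub continuous_const)
    have h2 : Continuous fun y : EuclideanSpace ℝ (Fin 3) => (y - z) iB :=
      (EuclideanSpace.proj iB).continuous.comp (continuous_id.sub continuous_const)
    exact h1.prodMk h2
  have hcrdz : crd z = 0 := by simp [hcrd]
  have hιcrd : ∀ y : EuclideanSpace ℝ (Fin 3), y 2 = z 2 → ι (crd y) = y := by
    intro y hy
    have hw : (y - z) 2 = 0 := by simp [hy]
    have hdec := eq_smul_add_smul_of_horizontal hA hB hAB hw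
    rw [hιq]
    simp only [hcrd]
    rw [← heA, ← heB] at hdec
    rw [add_assoc, ← hdec, add_sub_cancel]
  refine ⟨κ, crd ⁻¹' V, hcrdc.continuousAt.preimage_mem_nhds (by rw [hcrdz]; exact hV), fun y hy hy2 => ?_⟩
  obtain ⟨hfac, hne⟩ := hVprop (crd y) hy
  have hyι := hιcrd y hy2
  have hfB : fderiv ℝ f y eB ≠ 0 := by
    have h := hne
    rw [(h01 (crd y)).1, hyι] at h
    exact h
  refine ⟨?_, hfB⟩
  rw [hXiff y]
  -- `∂_A G(y), ∂_B G(y)` through the chart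
  have hGA : fderiv ℝ G y eA = κ (f y) * fderiv ℝ f y eA := by
    have h := congrArg (fun T : ℝ × ℝ →L[ℝ] ℝ => T (1, 0)) hfac
    simp only [FunLike.coe_smul, Pi.smul_apply, smul_eq_mul] at h
    rw [(h10 (crd y)).2, (h10 (crd y)).1, hyι] at h
    simpa [hft, hyι] using h
  have hGB : fderiv ℝ G y eB = κ (f y) * fderiv ℝ f y eB := by
    have h := congrArg (fun T : ℝ × ℝ →L[ℝ] ℝ => T (0, 1)) hfac
    simp only [FunLike.coe_smul, Pi.smul_apply, smul_eq_mul] at h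
    rw [(h01 (crd y)).2, (h01 (crd y)).1, hyι] at h
    simpa [hft, hyι] using h
  rw [hGA, hGB]
  constructor
  · rintro ⟨-, h2⟩
    rcases mul_eq_zero.1 h2 with h | h
    · exact h
    · exact absurd h hfB
  · intro h; simp [h]

/-- **Null chart.**  `X : ℝ³ → ℝ³` horizontal (`X₂ ≡ 0`) with a `C¹` planar stream function `G` (`∂₀G = −X₁`,
`∂₁G = X₀`), `f ∈ C¹(ℝ³)` with `Df(X) ≡ 0`, and `z` with `∇_h f(z) ≠ 0`.  Then for some `κ : ℝ → ℝ` and a neighbourhood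
`U` of `z`: every `y ∈ U` of the horizontal plane through `z` has `X y = 0 ↔ κ (f y) = 0`, and `∇_h f(y) ≠ 0`. -/
theorem exists_nullChart {X : EuclideanSpace ℝ (Fin 3) → EuclideanSpace ℝ (Fin 3)} (hX2 : ∀ y, X y 2 = 0)
    {f G : EuclideanSpace ℝ (Fin 3) → ℝ} (hf : ContDiff ℝ 1 f) (hG : ContDiff ℝ 1 G)
    (hG0 : ∀ y, fderiv ℝ G y (EuclideanSpace.single 0 1) = -(X y 1))
    (hG1 : ∀ y, fderiv ℝ G y (EuclideanSpace.single 1 1) = X y 0)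
    (hfX : ∀ y, fderiv ℝ f y (X y) = 0) {z : EuclideanSpace ℝ (Fin 3)}
    (hz : fderiv ℝ f z (EuclideanSpace.single 0 1) ≠ 0 ∨ fderiv ℝ f z (EuclideanSpace.single 1 1) ≠ 0) :
    ∃ κ : ℝ → ℝ, ∃ U ∈ 𝓝 z, ∀ y ∈ U, y 2 = z 2 →
      (X y = 0 ↔ κ (f y) = 0) ∧
      (fderiv ℝ f y (EuclideanSpace.single 0 1) ≠ 0 ∨ fderiv ℝ f y (EuclideanSpace.single 1 1) ≠ 0) := by
  -- `X y = 0 ↔ ∂₀G(y) = 0 ∧ ∂₁G(y) = 0`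
  have hXiff : ∀ y, X y = 0 ↔ fderiv ℝ G y (EuclideanSpace.single 0 1) = 0 ∧
      fderiv ℝ G y (EuclideanSpace.single 1 1) = 0 := by
    intro y
    rw [hG0, hG1, neg_eq_zero]
    constructor
    · intro h; simp [h]
    · rintro ⟨h1, h0⟩
      ext i
      fin_cases i
      · simpa using h0
      · simpa using h1
      · simpa using hX2 y
  -- the bracket `∂₀f·∂₁G − ∂₁f·∂₀G = Df(X) = 0`
  have hbr01 : ∀ y, fderiv ℝ f y (EuclideanSpace.single 0 1) * fderiv ℝ G y (EuclideanSpace.single 1 1) -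
      fderiv ℝ f y (EuclideanSpace.single 1 1) * fderiv ℝ G y (EuclideanSpace.single 0 1) = 0 := by
    intro y
    have h := hfX y
    rw [clm_apply_eq_sum_three, hX2, zero_mul, add_zero, ← hG1, show X y 1 = -fderiv ℝ G y (EuclideanSpace.single 0 1) by
      rw [hG0, neg_neg]] at h
    linarith
  rcases hz with hz0 | hz1
  · -- frame `(e₁, e₀)`
    have hbr10 : ∀ y, fderiv ℝ f y (EuclideanSpace.single 1 1) * fderiv ℝ G y (EuclideanSpace.single 0 1) -
        fderiv ℝ f y (EuclideanSpace.single 0 1) * fderiv ℝ G y (EuclideanSpace.single 1 1) = 0 :=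
      fun y => by linarith [hbr01 y]
    have hXiff' : ∀ y, X y = 0 ↔ fderiv ℝ G y (EuclideanSpace.single 1 1) = 0 ∧
        fderiv ℝ G y (EuclideanSpace.single 0 1) = 0 := fun y => by rw [hXiff y, and_comm]
    obtain ⟨κ, U, hU, hprop⟩ := exists_nullChart_frame hf hG (iA := 1) (iB := 0) (by decide) (by decide) (by decide)
      hbr10 hXiff' hz0
    exact ⟨κ, U, hU, fun y hy hy2 => ⟨(hprop y hy hy2).1, Or.inl (hprop y hy hy2).2⟩⟩
  · -- frame `(e₀, e₁)`
    obtain ⟨κ, U, hU, hprop⟩ := exists_nullChart_frame hf hG (iA := 0) (iB := 1) (by decide) (by decide) (by decide)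
      hbr01 hXiff hz1
    exact ⟨κ, U, hU, fun y hy hy2 => ⟨(hprop y hy hy2).1, Or.inr (hprop y hy hy2).2⟩⟩

end Summit.NavierStokesRegularity.NavierStokesRegularity.Theorems.PoloidalWindowDoorPoloidalWindowRigidityNullCharts

end
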